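import Mathlib.RingTheory.WittVector.TeichmullerSeries
import Mathlib.RingTheory.WittVector.Domain
import Mathlib.RingTheory.Valuation.Basic
import Mathlib.Analysis.SpecialFunctions.Pow.NNReal
import HarnessLib

/-!
# Witt-vector digit calculus: digit shift, carries, weighted digit bounds (solo programme, s78)

Infrastructure for the elementary proof of the injectivity of the Frobenius of `A_max = B_max⁺`
(input (I1) of the D2-cris ladder).  For a perfect domain `R` of characteristic `p` and `x ∈ W(R)`:

* `dshift x` with `x = [x₀] + p · dshift x` and `(dshift x)_k ^ p = x_{k+1}`;
* `([s] · x)_k = s^{p^k} x_k` and the carry `carry u u'` of `[u] + [u'] = [u+u'] + p · carry u u'`,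
  whose digits lie (after a `p`-th power) in `u'R`, and `carry u (u w) = [u] · carry 1 w`;
* for a valuation `v ≤ 1` on `R` with the valuation-ring divisibility property and a base `0 < ϱ < 1`,
  the weighted digit bounds `DigitLE t x : ∀ k, v(x_k) ϱ^{k p^k} ≤ t^{p^k}` (i.e. `x ∈ 𝔸_inf ∩ (ϱ-adic ball)`),
  the strict version `DigitLT`, and critical digits `Crit t x k` (equality); their behaviour under the digit
  shift, Teichmüller multiples, carries and sums, and the **leading-digit stability**
  `Crit t (x + e) k ↔ Crit t x k` for `DigitLE t x`, `DigitLT t e`.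

All statements are folklore consequences of the structure of Witt addition. [folklore]
-/

namespace Summit.Langlands.Langlands.Theorems.WittDigits

open WittVector NNReal

variable {p : ℕ} [hp : Fact p.Prime] {R : Type*} [CommRing R] [CharP R p] [PerfectRing R p]

/-! ## The digit shift -/

/-- The digit shift `dshift x := φ⁻¹((x − [x₀]).shift 1)`, so that `x = [x₀] + p · dshift x`. [folklore] -/
noncomputable def dshift (x : WittVector p R) : WittVector p R :=
  (WittVector.frobeniusEquiv p R).symm ((x - teichmuller p (x.coeff 0)).shift 1)

omit [CharP R p] [PerfectRing R p] in
/-- `(x − [x₀])₀ = 0`. [folklore] -/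
theorem coeff_sub_teichmuller_zero (x : WittVector p R) : (x - teichmuller p (x.coeff 0)).coeff 0 = 0 := by
  rw [← constantCoeff_apply, map_sub, constantCoeff_apply, constantCoeff_apply, teichmuller_coeff_zero, sub_self]

omit [CharP R p] [PerfectRing R p] in
/-- `(x − [x₀])_{i+1} = x_{i+1}` (disjoint supports). [folklore] -/
theorem coeff_sub_teichmuller_succ (x : WittVector p R) (i : ℕ) :
    (x - teichmuller p (x.coeff 0)).coeff (i + 1) = x.coeff (i + 1) := by
  have hdisj : ∀ n, (x - teichmuller p (x.coeff 0)).coeff n = 0 ∨ (teichmuller p (x.coeff 0)).coeff n = 0 := by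
    intro n
    rcases Nat.eq_zero_or_pos n with rfl | hn
    · exact Or.inl (coeff_sub_teichmuller_zero x)
    · exact Or.inr (teichmuller_coeff_pos p _ n hn)
  have h := coeff_add_of_disjoint (i + 1) (x - teichmuller p (x.coeff 0)) (teichmuller p (x.coeff 0)) hdisj
  rw [sub_add_cancel, teichmuller_coeff_pos p _ (i + 1) i.succ_pos, add_zero] at h
  exact h.symm

/-- `(φ⁻¹ y)_k ^ p = y_k`. [folklore] -/
theorem coeff_frobeniusEquiv_symm_pow (y : WittVector p R) (k : ℕ) :
    ((WittVector.frobeniusEquiv p R).symm y).coeff k ^ p = y.coeff k := by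
  have h := coeff_frobenius_charP (x := (WittVector.frobeniusEquiv p R).symm y) (n := k)
  rw [← WittVector.frobeniusEquiv_apply, RingEquiv.apply_symm_apply] at h
  exact h.symm

/-- **Digit decomposition** `x = [x₀] + p · dshift x`. [folklore] -/
theorem eq_teichmuller_add_mul_dshift (x : WittVector p R) :
    x = teichmuller p (x.coeff 0) + (p : WittVector p R) * dshift x := by
  set x' := x - teichmuller p (x.coeff 0) with hx'
  have hV : verschiebung (x'.shift 1) = x' := by
    have h := verschiebung_shift x' 0 (fun i hi => by
      obtain rfl : i = 0 := by omega
      exact coeff_sub_teichmuller_zero x)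
    have h0 : x'.shift 0 = x' := by ext n; simp [shift_coeff]
    exact h.trans h0
  have h2 : (p : WittVector p R) * dshift x = x' := by
    rw [dshift, ← hx', mul_comm, ← verschiebung_frobenius, ← WittVector.frobeniusEquiv_apply,
      RingEquiv.apply_symm_apply, hV]
  rw [h2, hx']; ring

/-- `(dshift x)_k ^ p = x_{k+1}`. [folklore] -/
theorem coeff_dshift_pow (x : WittVector p R) (k : ℕ) : (dshift x).coeff k ^ p = x.coeff (k + 1) := by
  rw [dshift, coeff_frobeniusEquiv_symm_pow, shift_coeff, Nat.add_comm 1 k, coeff_sub_teichmuller_succ]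

omit [PerfectRing R p] in
/-- `([w] + p y)₀ = w`. [folklore] -/
theorem coeff_teichmuller_add_mul_zero (w : R) (y : WittVector p R) :
    (teichmuller p w + (p : WittVector p R) * y).coeff 0 = w := by
  rw [add_coeff_zero, teichmuller_coeff_zero, mul_comm, mul_charP_coeff_zero, add_zero]

omit [PerfectRing R p] in
/-- `([w] + p y)_{k+1} = y_k ^ p`. [folklore] -/
theorem coeff_teichmuller_add_mul_succ (w : R) (y : WittVector p R) (k : ℕ) :
    (teichmuller p w + (p : WittVector p R) * y).coeff (k + 1) = y.coeff k ^ p := by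
  have hdisj : ∀ n, (teichmuller p w).coeff n = 0 ∨ ((p : WittVector p R) * y).coeff n = 0 := by
    intro n
    rcases Nat.eq_zero_or_pos n with rfl | hn
    · exact Or.inr (by rw [mul_comm, mul_charP_coeff_zero])
    · exact Or.inl (teichmuller_coeff_pos p _ n hn)
  rw [coeff_add_of_disjoint (k + 1) _ _ hdisj, teichmuller_coeff_pos p _ (k + 1) k.succ_pos, zero_add,
    mul_comm, mul_charP_coeff_succ]

/-- `[s] · x = [s x₀] + p · ([s] · dshift x)`. [folklore] -/
theorem teichmuller_mul_eq (s : R) (x : WittVector p R) :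
    teichmuller p s * x = teichmuller p (s * x.coeff 0) + (p : WittVector p R) * (teichmuller p s * dshift x) := by
  conv_lhs => rw [eq_teichmuller_add_mul_dshift x]
  rw [map_mul]; ring

/-- **Teichmüller scaling of digits**: `([s] · x)_k = s^{p^k} · x_k`. [folklore] -/
theorem coeff_teichmuller_mul (s : R) (x : WittVector p R) (k : ℕ) :
    (teichmuller p s * x).coeff k = s ^ p ^ k * x.coeff k := by
  induction k generalizing x with
  | zero => rw [pow_zero, pow_one, mul_coeff_zero, teichmuller_coeff_zero]
  | succ k ih =>
    rw [teichmuller_mul_eq, coeff_teichmuller_add_mul_succ, ih, mul_pow, ← pow_mul, ← pow_succ, coeff_dshift_pow]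

/-! ## Carries -/

/-- The carry of `[u] + [u']`: `[u] + [u'] = [u + u'] + p · carry u u'`. [folklore] -/
noncomputable def carry (u u' : R) : WittVector p R := dshift (teichmuller p u + teichmuller p u')

/-- `[u] + [u'] = [u + u'] + p · carry u u'`. [folklore] -/
theorem teichmuller_add_teichmuller (u u' : R) :
    teichmuller p u + teichmuller p u' = teichmuller p (u + u') + (p : WittVector p R) * carry u u' := by
  have h := eq_teichmuller_add_mul_dshift (teichmuller p u + teichmuller p u')
  rw [add_coeff_zero, teichmuller_coeff_zero, teichmuller_coeff_zero] at h
  exact h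

/-- `carry u u' = carry u' u`. [folklore] -/
theorem carry_comm (u u' : R) : (carry u u' : WittVector p R) = carry u' u := by
  rw [carry, carry, add_comm]

/-- **The carry digits are divisible by `u'`** (after a `p`-th power): `(carry u u')_k ^ p ∈ u'R`, because
`[u] + [u'] − [u+u']` dies in `W(R/u'R)`. [folklore] -/
theorem coeff_carry_pow_mem (u u' : R) (k : ℕ) : (carry u u' : WittVector p R).coeff k ^ p ∈ Ideal.span {u'} := by
  have hD : (p : WittVector p R) * carry u u' = teichmuller p u + teichmuller p u' - teichmuller p (u + u') := by
    rw [teichmuller_add_teichmuller]; ring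
  have h1 : (carry u u' : WittVector p R).coeff k ^ p =
      (teichmuller p u + teichmuller p u' - teichmuller p (u + u')).coeff (k + 1) := by
    rw [← hD, mul_comm, mul_charP_coeff_succ]
  let π : R →+* R ⧸ Ideal.span ({u'} : Set R) := Ideal.Quotient.mk _
  have hπ : π u' = 0 := Ideal.Quotient.eq_zero_iff_mem.2 (Ideal.mem_span_singleton_self u')
  have hmap : WittVector.map π (teichmuller p u + teichmuller p u' - teichmuller p (u + u')) = 0 := by
    rw [map_sub, map_add, map_teichmuller, map_teichmuller, map_teichmuller, map_add π, hπ, add_zero,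
      teichmuller_zero, add_zero, sub_self]
  have h2 := congrArg (fun y : WittVector p (R ⧸ Ideal.span ({u'} : Set R)) => y.coeff (k + 1)) hmap
  simp only [map_coeff, zero_coeff] at h2
  rw [h1, ← Ideal.Quotient.eq_zero_iff_mem]
  exact h2

variable [IsDomain R]

omit [PerfectRing R p] in
/-- `p ≠ 0` in `W(R)`. [folklore] -/
theorem natCast_p_ne_zero : (p : WittVector p R) ≠ 0 := fun h => by
  have h1 := congrArg (fun x : WittVector p R => x.coeff 1) h
  simp only [coeff_p_one, zero_coeff] at h1
  exact one_ne_zero h1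

omit [PerfectRing R p] in
/-- **Uniqueness of the digit decomposition**: `[u] + p b = [u'] + p b' ⇒ u = u' ∧ b = b'`. [folklore] -/
theorem teichmuller_add_mul_inj {u u' : R} {b b' : WittVector p R}
    (h : teichmuller p u + (p : WittVector p R) * b = teichmuller p u' + (p : WittVector p R) * b') :
    u = u' ∧ b = b' := by
  have h0 := congrArg (fun x : WittVector p R => x.coeff 0) h
  simp only [coeff_teichmuller_add_mul_zero] at h0
  refine ⟨h0, ?_⟩
  rw [h0] at h
  exact mul_left_cancel₀ natCast_p_ne_zero (add_left_cancel h)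

/-- **Homogeneity of carries**: `carry u (u w) = [u] · carry 1 w`. [folklore] -/
theorem carry_mul_right (u w : R) : (carry u (u * w) : WittVector p R) = teichmuller p u * carry 1 w := by
  have h1 := teichmuller_add_teichmuller (p := p) u (u * w)
  have h2 := teichmuller_add_teichmuller (p := p) (1 : R) w
  have h3 : teichmuller p (u + u * w) + (p : WittVector p R) * carry u (u * w) =
      teichmuller p (u + u * w) + (p : WittVector p R) * (teichmuller p u * carry 1 w) := by
    rw [← h1]
    have e1 : teichmuller p u + teichmuller p (u * w) = teichmuller p u * (teichmuller p 1 + teichmuller p w) := by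
      rw [map_mul, map_one]; ring
    rw [e1, h2, show u + u * w = u * (1 + w) by ring, map_mul]; ring
  exact (teichmuller_add_mul_inj h3).2

end Summit.Langlands.Langlands.Theorems.WittDigits
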